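import Mathlib
import Summits.Ventures.PercRepro2.HallReading
import Summits.Ventures.PercRepro2.PatternV2SP

/-! # The pattern reading of (V2), the count (U), and the Harris condition on every pattern cube
(seat mine-b, cell pub-perc-repro2; MINE-B.md §19.2, §19.6–19.7; = the former PatternHall.lean + PatternHarris.lean)

The colour swap `S ↦ Y ∖ S` is an order-reversing involution of `Conf Y` exchanging the two flow
labels (`rLabP_swap`, `bLabP_swap`).  Through it, up-set domination for `(rLabP, bLabP)` is up-set
domination of the order dual for the swapped labels (`upDom_dual`), and the Hall reading of
`HallReading.lean` becomes the statement of MINE-B.md §19.2: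

  **on every series–parallel pattern, every configuration `γ` with `F_R(γ) = 0` and `F_B(γ) ≥ 2`
  owns `F_B(γ)` private configurations `γ′ ⊆ γ` with `F_B(γ′) = 1` and `F_R(γ′) ≥ 1`**
  (`IsSP.exists_private_targets`), with the count (U) at graph level (`IsSP.U_nonneg`).

Second part: on the configuration cube of ANY pattern, `{b = 0}` is a lower set and `{r = 0}` an
upper set of the same size (the colour swap exchanges them), so Harris–Kleitman twice gives the
Harris condition `#(V ∩ {b = 0}) ≤ #(V ∩ {r = 0})` for every upper set `V` (`harris_pattern`); hence
the graph-level closure theorems need only (V2) of the parts: **the class of patterns satisfying (V2)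
is closed under series and parallel composition** (`upDom_series_pattern`, `upDom_parallel_pattern`). -/

open Finset
namespace Summit.Ventures.PercRepro2.V2Closure

section Swap

variable {V : Type*} {E : Type*} [DecidableEq E]

/-- The colour swap on configurations, as an order isomorphism onto the order dual. -/
def swapIso (Y : Finset E) : Conf Y ≃o (Conf Y)ᵒᵈ where
  toFun S := OrderDual.toDual ⟨Y \ S.1, Finset.sdiff_subset⟩
  invFun T := ⟨Y \ (OrderDual.ofDual T).1, Finset.sdiff_subset⟩
  left_inv S := by
    apply Subtype.ext
    simp only [OrderDual.ofDual_toDual]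
    exact Finset.sdiff_sdiff_eq_self S.2
  right_inv T := by
    apply OrderDual.toDual.injective
    apply Subtype.ext
    exact Finset.sdiff_sdiff_eq_self (OrderDual.ofDual T).2
  map_rel_iff' := by
    intro S T
    simp only [Equiv.coe_fn_mk, OrderDual.toDual_le_toDual, Subtype.mk_le_mk]
    constructor
    · intro h e he
      -- Y \ T ⊆ Y \ S  →  S ⊆ T  (both inside Y)
      by_contra hT
      have : e ∈ Y \ T.1 := Finset.mem_sdiff.2 ⟨S.2 he, hT⟩
      exact (Finset.mem_sdiff.1 (h this)).2 he
    · intro h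
      exact Finset.sdiff_subset_sdiff le_rfl h

/-- the red label of the swap is the blue label -/
lemma rLabP_swap (ends : E → Sym2 V) (s t : V) (O Y : Finset E) (S : Conf Y) :
    rLabP ends s t O Y (OrderDual.ofDual (swapIso Y S)) = bLabP ends s t O Y S := by
  unfold rLabP bLabP
  simp only [swapIso, RelIso.coe_fn_mk, Equiv.coe_fn_mk, OrderDual.ofDual_toDual]
  rw [Finset.sdiff_sdiff_eq_self S.2]

/-- the blue label of the swap is the red label -/
lemma bLabP_swap (ends : E → Sym2 V) (s t : V) (O Y : Finset E) (S : Conf Y) :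
    bLabP ends s t O Y (OrderDual.ofDual (swapIso Y S)) = rLabP ends s t O Y S := by
  unfold rLabP bLabP
  simp only [swapIso, RelIso.coe_fn_mk, Equiv.coe_fn_mk, OrderDual.ofDual_toDual]

/-- **up-set domination transfers to the order dual with swapped labels** -/
theorem upDom_dual [Fintype E] (ends : E → Sym2 V) (s t : V) (O Y : Finset E)
    (h : UpDom (rLabP ends s t O Y) (bLabP ends s t O Y)) :
    UpDom (X := (Conf Y)ᵒᵈ) (fun T => bLabP ends s t O Y (OrderDual.ofDual T))
      (fun T => rLabP ends s t O Y (OrderDual.ofDual T)) :=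
  upDom_of_orderIso (swapIso Y) _ _ _ _ (fun S => bLabP_swap ends s t O Y S)
    (fun S => rLabP_swap ends s t O Y S) h

/-- **Private targets on every series–parallel pattern**: every configuration `γ` with `F_R = 0`,
`F_B ≥ 2` owns `F_B(γ)` private configurations `γ′ ⊆ γ` with `F_B(γ′) = 1`, `F_R(γ′) ≥ 1`
(an injective map on the slots `(γ, i < F_B γ)`). -/
theorem IsSP.exists_private_targets [DecidableEq V] [Fintype E] {ends : E → Sym2 V} {s t : V}
    {O Y : Finset E} (h : IsSP ends s t O Y) :
    ∃ f : {p : {γ : Conf Y // rLabP ends s t O Y γ = 0 ∧ 2 ≤ bLabP ends s t O Y γ}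
        × Fin (bound (fun T : (Conf Y)ᵒᵈ => bLabP ends s t O Y (OrderDual.ofDual T))) //
        p.2.val < bLabP ends s t O Y p.1.1} → Conf Y,
      Function.Injective f ∧
        ∀ p, f p ≤ p.1.1.1 ∧ bLabP ends s t O Y (f p) = 1 ∧ 1 ≤ rLabP ends s t O Y (f p) := by
  obtain ⟨g, hg, hspec⟩ := exists_private_targets_of_upDom (X := (Conf Y)ᵒᵈ)
    (fun T => bLabP ends s t O Y (OrderDual.ofDual T))
    (fun T => rLabP ends s t O Y (OrderDual.ofDual T)) (upDom_dual ends s t O Y h.upDom)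
  -- the slot of the dual attached to a slot of the pattern
  let ι := fun p : {p : {γ : Conf Y // rLabP ends s t O Y γ = 0 ∧ 2 ≤ bLabP ends s t O Y γ}
        × Fin (bound (fun T : (Conf Y)ᵒᵈ => bLabP ends s t O Y (OrderDual.ofDual T))) //
        p.2.val < bLabP ends s t O Y p.1.1} =>
    (⟨(⟨OrderDual.toDual p.1.1.1, p.1.1.2⟩, p.1.2), p.2⟩ :
      Slot (fun T : (Conf Y)ᵒᵈ => bLabP ends s t O Y (OrderDual.ofDual T))
        (fun T : (Conf Y)ᵒᵈ => rLabP ends s t O Y (OrderDual.ofDual T)))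
  have hι : Function.Injective ι := by
    intro p q hpq
    simp only [ι, Subtype.mk.injEq, Prod.mk.injEq] at hpq
    apply Subtype.ext
    apply Prod.ext
    · exact Subtype.ext (OrderDual.toDual.injective hpq.1)
    · exact hpq.2
  refine ⟨fun p => OrderDual.ofDual (g (ι p)), fun p q hpq => hι (hg (OrderDual.ofDual.injective hpq)),
    fun p => ?_⟩
  obtain ⟨hle, h1, h2⟩ := hspec (ι p)
  exact ⟨hle, h1, h2⟩


/-- the `b`-weighted mass of `{r = 0}` equals the `r`-weighted mass of `{b = 0}` (colour swap) -/
lemma sum_red_zero_blue_eq_swap [Fintype E] (ends : E → Sym2 V) (s t : V) (O Y : Finset E) :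
    ∑ S : Conf Y, (if rLabP ends s t O Y S = 0 then (bLabP ends s t O Y S : ℤ) else 0)
      = ∑ S : Conf Y, (if bLabP ends s t O Y S = 0 then (rLabP ends s t O Y S : ℤ) else 0) := by
  refine Fintype.sum_equiv ((swapIso Y).toEquiv.trans OrderDual.ofDual) _ _ (fun S => ?_)
  have h1 := rLabP_swap ends s t O Y S
  have h2 := bLabP_swap ends s t O Y S
  simp only [Equiv.trans_apply, OrderIso.coe_toEquiv]
  rw [h1, h2]

/-- **The count (U) on every series–parallel pattern, at graph level**:
`#{F_R = 1} ≥ Σ_{F_R = 0} F_B` (the swap turns `ν′`-mass into the (U) count). -/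
theorem IsSP.U_nonneg [DecidableEq V] [Fintype E] {ends : E → Sym2 V} {s t : V} {O Y : Finset E}
    (h : IsSP ends s t O Y) :
    ∑ S : Conf Y, (if rLabP ends s t O Y S = 0 then (bLabP ends s t O Y S : ℤ) else 0)
      ≤ ∑ S : Conf Y, (if rLabP ends s t O Y S = 1 then (1 : ℤ) else 0) := by
  have h0 := h.sum_nu'_nonneg
  rw [sum_red_zero_blue_eq_swap]
  -- ν′ = [r = 1 ∧ b ≥ 1] − r·[b = 0 ∧ r ≥ 2]; the missing pieces of both sides are `{r = 1, b = 0}`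
  have e : ∀ S : Conf Y, nu' (rLabP ends s t O Y) (bLabP ends s t O Y) S
      = (if rLabP ends s t O Y S = 1 then (1 : ℤ) else 0)
        - (if bLabP ends s t O Y S = 0 then (rLabP ends s t O Y S : ℤ) else 0) := by
    intro S; unfold nu'
    split_ifs <;> omega
  simp only [e, Finset.sum_sub_distrib] at h0
  linarith

end Swap





section Harris

variable {V : Type*} {E : Type*} [DecidableEq E]

/-- Configurations of `Y` as finsets of the subtype `↥Y`: an order isomorphism. -/
def confEquiv (Y : Finset E) : Conf Y ≃o Finset (↥Y) where
  toFun S := S.1.subtype (· ∈ Y)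
  invFun T := ⟨T.map (Function.Embedding.subtype _), by
    intro e he
    obtain ⟨⟨e', he'⟩, _, rfl⟩ := Finset.mem_map.1 he
    exact he'⟩
  left_inv S := by
    apply Subtype.ext
    exact Finset.subtype_map_of_mem (fun e he => S.2 he)
  right_inv T := by
    ext ⟨e, he⟩
    simp only [Finset.mem_subtype, Finset.mem_map, Function.Embedding.coe_subtype]
    constructor
    · rintro ⟨⟨e', he'⟩, hmem, h⟩
      simp only at h; subst h; exact hmem
    · intro h; exact ⟨⟨e, he⟩, h, rfl⟩
  map_rel_iff' := by
    intro S T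
    simp only [Equiv.coe_fn_mk]
    constructor
    · intro h
      show S.1 ⊆ T.1
      intro e he
      have : (⟨e, S.2 he⟩ : ↥Y) ∈ S.1.subtype (· ∈ Y) := by simp [he]
      have := h this
      simpa using this
    · intro h
      exact Finset.subtype_mono h

/-- the blue label is monotone in the configuration -/
lemma bLabP_mono {ends : E → Sym2 V} {s t : V} (hst : s ≠ t) (O Y : Finset E) :
    Monotone (bLabP ends s t O Y) := by
  intro S T h
  unfold bLabP
  exact flow_mono hst (Finset.union_subset_union le_rfl h)

/-- the red label is antitone in the configuration -/
lemma rLabP_anti {ends : E → Sym2 V} {s t : V} (hst : s ≠ t) (O Y : Finset E) :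
    Antitone (rLabP ends s t O Y) := by
  intro S T h
  unfold rLabP
  exact flow_mono hst (Finset.union_subset_union le_rfl (Finset.sdiff_subset_sdiff le_rfl h))

variable [Fintype E]

omit [Fintype E] in
/-- the image of an upper set of `Conf Y` is an upper set of `Finset ↥Y` -/
lemma image_confEquiv_isUpperSet (Y : Finset E) (A : Finset (Conf Y)) (hA : IsUpperSet (↑A : Set (Conf Y))) :
    IsUpperSet (↑(A.image (confEquiv Y)) : Set (Finset ↥Y)) := by
  intro T T' hTT' hT
  simp only [coe_image, Set.mem_image, Finset.mem_coe] at hT ⊢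
  obtain ⟨S, hS, rfl⟩ := hT
  refine ⟨(confEquiv Y).symm T', hA ?_ hS, by simp⟩
  rw [← (confEquiv Y).symm_apply_apply S]
  exact (confEquiv Y).symm.monotone hTT'

omit [Fintype E] in
/-- the image of a lower set of `Conf Y` is a lower set of `Finset ↥Y` -/
lemma image_confEquiv_isLowerSet (Y : Finset E) (A : Finset (Conf Y)) (hA : IsLowerSet (↑A : Set (Conf Y))) :
    IsLowerSet (↑(A.image (confEquiv Y)) : Set (Finset ↥Y)) := by
  intro T T' hTT' hT
  simp only [coe_image, Set.mem_image, Finset.mem_coe] at hT ⊢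
  obtain ⟨S, hS, rfl⟩ := hT
  refine ⟨(confEquiv Y).symm T', hA ?_ hS, by simp⟩
  rw [← (confEquiv Y).symm_apply_apply S]
  exact (confEquiv Y).symm.monotone hTT'

/-- the two zero sets have the same size (the colour swap exchanges them) -/
lemma card_blue_zero_eq_red_zero (ends : E → Sym2 V) (s t : V) (O Y : Finset E) :
    (univ.filter (fun S : Conf Y => bLabP ends s t O Y S = 0)).card
      = (univ.filter (fun S : Conf Y => rLabP ends s t O Y S = 0)).card := by
  apply Finset.card_bij (fun S _ => OrderDual.ofDual (swapIso Y S))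
  · intro S hS
    simp only [mem_filter, mem_univ, true_and] at hS ⊢
    rw [rLabP_swap]; exact hS
  · intro S _ S' _ h
    exact (swapIso Y).injective (OrderDual.ofDual.injective h)
  · intro T hT
    refine ⟨(swapIso Y).symm (OrderDual.toDual T), ?_, by simp⟩
    simp only [mem_filter, mem_univ, true_and] at hT ⊢
    have := rLabP_swap ends s t O Y ((swapIso Y).symm (OrderDual.toDual T))
    rw [OrderIso.apply_symm_apply, OrderDual.ofDual_toDual] at this
    rw [← this]; exact hT

/-- **(HC) on every pattern cube** (Harris–Kleitman twice). -/
theorem harris_pattern {ends : E → Sym2 V} {s t : V} (hst : s ≠ t) (O Y : Finset E) :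
    HarrisCond (rLabP ends s t O Y) (bLabP ends s t O Y) := by
  intro A hA
  -- counts as cardinalities of filters
  have e1 : ∑ S ∈ A, (if bLabP ends s t O Y S = 0 then (1 : ℤ) else 0)
      = ((A.filter (fun S => bLabP ends s t O Y S = 0)).card : ℤ) := by
    rw [Finset.card_filter]; push_cast; rfl
  have e2 : ∑ S ∈ A, (if rLabP ends s t O Y S = 0 then (1 : ℤ) else 0)
      = ((A.filter (fun S => rLabP ends s t O Y S = 0)).card : ℤ) := by
    rw [Finset.card_filter]; push_cast; rfl
  rw [e1, e2]
  -- the families in `Finset ↥Y`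
  set e := confEquiv Y
  set B0 : Finset (Conf Y) := univ.filter (fun S => bLabP ends s t O Y S = 0) with hB0
  set R0 : Finset (Conf Y) := univ.filter (fun S => rLabP ends s t O Y S = 0) with hR0
  have hB0l : IsLowerSet (↑B0 : Set (Conf Y)) := by
    intro S T hTS hS
    simp only [hB0, coe_filter, mem_univ, true_and, Set.mem_setOf_eq] at hS ⊢
    exact Nat.le_zero.1 (hS ▸ bLabP_mono hst O Y hTS)
  have hR0u : IsUpperSet (↑R0 : Set (Conf Y)) := by
    intro S T hST hS
    simp only [hR0, coe_filter, mem_univ, true_and, Set.mem_setOf_eq] at hS ⊢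
    exact Nat.le_zero.1 (hS ▸ rLabP_anti hst O Y hST)
  have hinj : Function.Injective e := e.injective
  have h1 := (image_confEquiv_isUpperSet Y A hA).card_inter_le_finset (image_confEquiv_isLowerSet Y B0 hB0l)
  have h2 := (image_confEquiv_isUpperSet Y A hA).le_card_inter_finset (image_confEquiv_isUpperSet Y R0 hR0u)
  rw [← Finset.image_inter _ _ hinj, Finset.card_image_of_injective _ hinj,
    Finset.card_image_of_injective _ hinj, Finset.card_image_of_injective _ hinj] at h1
  rw [← Finset.image_inter _ _ hinj, Finset.card_image_of_injective _ hinj,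
    Finset.card_image_of_injective _ hinj, Finset.card_image_of_injective _ hinj] at h2
  have hcard : B0.card = R0.card := card_blue_zero_eq_red_zero ends s t O Y
  have hAB : A.filter (fun S => bLabP ends s t O Y S = 0) = A ∩ B0 := by
    ext S; simp [hB0]
  have hAR : A.filter (fun S => rLabP ends s t O Y S = 0) = A ∩ R0 := by
    ext S; simp [hR0]
  rw [hAB, hAR]
  have hpos : 0 < 2 ^ Fintype.card ↥Y := by positivity
  have : 2 ^ Fintype.card ↥Y * (A ∩ B0).card ≤ 2 ^ Fintype.card ↥Y * (A ∩ R0).card := by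
    calc 2 ^ Fintype.card ↥Y * (A ∩ B0).card ≤ A.card * B0.card := h1
      _ = A.card * R0.card := by rw [hcard]
      _ ≤ 2 ^ Fintype.card ↥Y * (A ∩ R0).card := h2
  exact_mod_cast Nat.le_of_mul_le_mul_left this hpos

/-- **(V2) is closed under series composition of arbitrary patterns.** -/
theorem upDom_series_pattern [DecidableEq V] {ends : E → Sym2 V} {s v t : V} {O₁ Y₁ O₂ Y₂ : Finset E}
    (hE : SharesOnlyVertex ends v (O₁ ∪ Y₁) (O₂ ∪ Y₂)) (hs : ∀ e ∈ O₂ ∪ Y₂, s ∉ ends e)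
    (ht : ∀ e ∈ O₁ ∪ Y₁, t ∉ ends e) (hsv : s ≠ v) (htv : t ≠ v) (hst : s ≠ t)
    (hdisj : Disjoint (O₁ ∪ Y₁) (O₂ ∪ Y₂)) (hdY : Disjoint Y₁ Y₂)
    (h₁ : UpDom (rLabP ends s v O₁ Y₁) (bLabP ends s v O₁ Y₁))
    (h₂ : UpDom (rLabP ends v t O₂ Y₂) (bLabP ends v t O₂ Y₂)) :
    UpDom (rLabP ends s t (O₁ ∪ O₂) (Y₁ ∪ Y₂)) (bLabP ends s t (O₁ ∪ O₂) (Y₁ ∪ Y₂)) :=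
  (upDom_harris_series hE hs ht hsv htv hst hdisj hdY ⟨h₁, harris_pattern hsv O₁ Y₁⟩
    ⟨h₂, harris_pattern (Ne.symm htv) O₂ Y₂⟩).1

/-- **(V2) is closed under parallel composition of arbitrary patterns.** -/
theorem upDom_parallel_pattern [DecidableEq V] {ends : E → Sym2 V} {s t : V} {O₁ Y₁ O₂ Y₂ : Finset E}
    (hE : SharesOnlyPair ends s t (O₁ ∪ Y₁) (O₂ ∪ Y₂)) (hst : s ≠ t)
    (hdisj : Disjoint (O₁ ∪ Y₁) (O₂ ∪ Y₂)) (hdY : Disjoint Y₁ Y₂)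
    (h₁ : UpDom (rLabP ends s t O₁ Y₁) (bLabP ends s t O₁ Y₁))
    (h₂ : UpDom (rLabP ends s t O₂ Y₂) (bLabP ends s t O₂ Y₂)) :
    UpDom (rLabP ends s t (O₁ ∪ O₂) (Y₁ ∪ Y₂)) (bLabP ends s t (O₁ ∪ O₂) (Y₁ ∪ Y₂)) :=
  (upDom_harris_parallel hE hst hdisj hdY ⟨h₁, harris_pattern hst O₁ Y₁⟩
    ⟨h₂, harris_pattern hst O₂ Y₂⟩).1

end Harris

end Summit.Ventures.PercRepro2.V2Closure
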